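import Literature.Geometry.Riemannian.ExpMapHopfRinow
import Literature.Geometry.Riemannian.CutLocusBishopExp
import HarnessLib

/-!
# The metric cut locus is Lee's `Cut(p) = exp_p(TCL(p))` on complete Riemannian manifolds

Topic `Geometry/Riemannian`; fourth support file of the programme towards the named fact
`Literature.Geometry.Riemannian.buchner1977_cutLocus_triangulable` of `CutLocus.lean`
(M. A. Buchner, *Simplicial structure of the real analytic cut locus*, Proc. AMS 64 (1977)
118–121). Buchner's `C(p)` (p. 118: "the cut point of `p` along `γ` is the first point `γ(t₀)`
such that for `t > t₀`, `γ` no longer minimizes arclength. The set of all cut points for all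
geodesics starting from `p` is called the cut locus `C(p)`") is the GEODESIC cut locus — in the
tree, Lee's `Cut(p) = exp_p(TCL(p))`, `geodesicCutLocus g hg p` of `ExponentialMap.lean` — while
the fact is vendored for the METRIC cut locus `cutLocus g hg p` of `CutLocus.lean`
(`{q ≠ p | ∀ r, d(p,r) = d(p,q) + d(q,r) → r = q}`), whose identification with `Cut(p)` on
complete manifolds both files record as "NOT vendored". This file PROVES the identification
(`cutLocus_eq_geodesicCutLocus`): for a smooth Riemannian metric on a connected Hausdorff manifold
without boundary whose Levi-Civita connection is geodesically complete — in particular on every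
compact one (`cutLocus_eq_geodesicCutLocus_of_compactSpace`, through
`hopfRinow_compact_geodesicallyComplete`) —
`cutLocus g hg p = geodesicCutLocus g hg p`.

## The argument (Chavel 2006, §III.2 / Lee 2018, proof of Prop. 10.32 and Thm. 10.34 (c))

* `mem_tangentCutLocus_of_mem_cutLocus`: if `q ∈ cutLocus p` and `γ_v|[0,1]` is a minimizing
  geodesic segment from `p` to `q` (one exists by Hopf–Rinow,
  `exists_isMinimizingUpTo_of_isGeodesicallyComplete`), then `v ∈ TCL(p)`: were `γ_v` minimizing
  on `[0, s]`, `s > 1`, the point `r = γ_v(s)` would satisfy `d(p,r) = s|v| = d(p,q) + d(q,r)`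
  (lengths of geodesic segments, `length_maximalGeodesic`), forcing `r = q`, i.e. `s|v| = |v|`.
* `expMap_mem_cutLocus_of_mem_tangentCutLocus`: if `v ∈ TCL(p)` then `q = exp_p v ∈ cutLocus p`.
  Given `r ≠ q` with `d(p,r) = d(p,q) + d(q,r)`, join `q` to `r` by a minimizing segment
  `γ_w|[0,1]` (Hopf–Rinow). If `w` is positively proportional to `γ_v'(1)`, uniqueness of
  geodesics (the flow/translation property `maximalGeodesic_velocity_apply` and the rescaling lemma
  `maximalGeodesic_smul`) makes `r = γ_v(s)` with `s = 1 + |w|/|v| > 1` and `γ_v|[0,s]`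
  minimizing — contradicting `v ∈ TCL(p)`. Otherwise the broken geodesic `γ_v|[0,1] ∗ γ_w|[0,1]`
  has a genuine corner at `q` and **corner cutting** (`exists_edist_riemannianExpMap_neg_smul_lt`,
  `ExpMapCornerCutting.lean`: `d(exp_q(-s û), exp_q(s ŵ)) < 2s` for distinct unit vectors) gives
  `d(p,r) < d(p,q) + d(q,r)`.
* `cutLocus_eq_geodesicCutLocus` assembles the two inclusions with Hopf–Rinow; the corollary
  `mem_tangentCutLocus_iff_expMap_mem_cutLocus` characterises `TCL(p)` among the minimizing `v ≠ 0`.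

No definitions, no named facts (D-0026); theorem-only file.

## References

* [Buchner1977Simplicial] M. A. Buchner, Proc. AMS 64 (1977), p. 118 (definition of `C(p)`).
* [LeeRiemannianManifolds2018] J. M. Lee, Introduction to Riemannian Manifolds, 2nd ed. (2018),
  pp. 307–310 (`t_cut`, `TCL(p)`, `Cut(p)`), Prop. 10.32, Thm. 10.34.
* [Chavel2006] I. Chavel, Riemannian geometry: a modern introduction, 2nd ed. (2006), §III.2.
-/

noncomputable section

open Bundle Set Filter Manifold
open scoped Manifold ContDiff Topology ENNReal NNReal

namespace Literature.Geometry.Riemannian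

open Literature.Geometry.Lorentzian
open Literature.Geometry.Lorentzian.PseudoRiemannianMetric

variable {E : Type*} [NormedAddCommGroup E] [NormedSpace ℝ E] {H : Type*} [TopologicalSpace H]
  {I : ModelWithCorners ℝ E H} {M : Type*} [TopologicalSpace M] [ChartedSpace H M]
  [IsManifold I ∞ M] {n : ℕ∞ω} [FiniteDimensional ℝ E] [CompleteSpace E] [T2Space M]
  [BoundarylessManifold I M]
  {g : PseudoRiemannianMetric I n E (TangentSpace I : M → Type _)} [g.HasLeviCivita]
  [CovariantDerivative.ContMDiffCovariantDerivative g.leviCivita 1]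

omit [IsManifold I ∞ M] [FiniteDimensional ℝ E] [CompleteSpace E] [T2Space M]
  [BoundarylessManifold I M] [g.HasLeviCivita]
  [CovariantDerivative.ContMDiffCovariantDerivative g.leviCivita 1] in
/-- A smooth exponent is at least `1` (bookkeeping for the `[Fact (1 ≤ n)]` of the speed lemmas).
[folklore] -/
theorem fact_one_le_of_infty_le (hn : (∞ : ℕ∞ω) ≤ n) : Fact (1 ≤ n) :=
  ⟨le_trans (by exact_mod_cast (le_top : (1 : ℕ∞) ≤ ⊤)) hn⟩

/-! ### Distances along a minimizing segment -/

/-- Along a minimizing segment `γ_v|[0,1]`: `d(p, exp_p(t v)) = t |v|_g` for `t ∈ [0, 1]`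
(`edist_expMap_smul_of_isMinimizingUpTo` with `exp_p 0 = p` and `d(p, exp_p v) = |v|_g`).
[cite: LeeRiemannianManifolds2018, Prop. 10.32 (a) (proof)] -/
theorem edist_self_expMap_smul_of_isMinimizingUpTo [Fact (1 ≤ n)] (hg : g.IsRiemannian)
    (hc : IsGeodesicallyComplete g.leviCivita) {p : M} {v : TangentSpace I p}
    (hmin : IsMinimizingUpTo g hg p v 1) {t : ℝ} (ht : t ∈ Icc (0 : ℝ) 1) :
    g.edist hg p (riemannianExpMap g p (t • v)) =
      ENNReal.ofReal (t * Real.sqrt (g.val p v v)) := by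
  have h := edist_expMap_smul_of_isMinimizingUpTo hg hc hmin 0 ⟨le_rfl, zero_le_one⟩ t ht
  rw [zero_smul, riemannianExpMap_zero, zero_sub, abs_neg, abs_of_nonneg ht.1,
    edist_eq_of_isMinimizingUpTo hg hc hmin, ← ENNReal.ofReal_mul ht.1] at h
  exact h

/-- Along a minimizing segment `γ_v|[0,1]`: `d(exp_p(t v), exp_p v) = (1 - t) |v|_g` for
`t ∈ [0, 1]`. [cite: LeeRiemannianManifolds2018, Prop. 10.32 (a) (proof)] -/
theorem edist_expMap_smul_expMap_of_isMinimizingUpTo [Fact (1 ≤ n)] (hg : g.IsRiemannian)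
    (hc : IsGeodesicallyComplete g.leviCivita) {p : M} {v : TangentSpace I p}
    (hmin : IsMinimizingUpTo g hg p v 1) {t : ℝ} (ht : t ∈ Icc (0 : ℝ) 1) :
    g.edist hg (riemannianExpMap g p (t • v)) (riemannianExpMap g p v) =
      ENNReal.ofReal ((1 - t) * Real.sqrt (g.val p v v)) := by
  have h := edist_expMap_smul_of_isMinimizingUpTo hg hc hmin t ht 1 ⟨zero_le_one, le_rfl⟩
  rw [one_smul, abs_sub_comm, abs_of_nonneg (sub_nonneg.2 ht.2),
    edist_eq_of_isMinimizingUpTo hg hc hmin, ← ENNReal.ofReal_mul (sub_nonneg.2 ht.2)] at h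
  exact h

/-- **Geodesics issuing from `γ_v(1)` in the direction `c γ_v'(1)` stay on `γ_v`**:
`exp_{γ_v(1)}(c γ_v'(1)) = γ_v(c + 1)` (rescaling `expMap_smul` and the translation property
`maximalGeodesic_velocity_apply`; Lee 2018, Lemma 5.18 and proof of Thm. 6.19).
[cite: LeeRiemannianManifolds2018, Lemma 5.18] -/
theorem expMap_smul_velocity_one (hc : IsGeodesicallyComplete g.leviCivita) (p : M)
    (v : TangentSpace I p) (c : ℝ) :
    riemannianExpMap g (maximalGeodesic g.leviCivita p v 1)
        (c • velocity I (maximalGeodesic g.leviCivita p v) 1) =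
      maximalGeodesic g.leviCivita p v (c + 1) := by
  rw [riemannianExpMap_eq, expMap_smul hc, maximalGeodesic_velocity_apply hc p v 1 c]

/-! ### From the metric cut locus to the tangent cut locus -/

/-- **A minimizing segment to a point of the metric cut locus cannot be prolonged minimally**:
if `q ∈ cutLocus p`, `γ_v|[0,1]` is minimizing and `exp_p v = q`, then `v ∈ TCL(p)`. Indeed
`v ≠ 0` (as `q ≠ p`), and if `γ_v|[0,s]` were minimizing for some `s > 1`, then with
`r = γ_v(s)`: `d(p,r) = s|v|`, `d(p,q) = |v|`, `d(q,r) ≤ (s-1)|v|`, so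
`d(p,r) = d(p,q) + d(q,r)` and the cut-locus property gives `r = q`, whence `s|v| = |v|`,
`s = 1`. [cite: LeeRiemannianManifolds2018, pp. 308–310] -/
theorem mem_tangentCutLocus_of_mem_cutLocus (hn : (∞ : ℕ∞ω) ≤ n) (hg : g.IsRiemannian)
    (hc : IsGeodesicallyComplete g.leviCivita) {p q : M} (hq : q ∈ cutLocus g hg p)
    {v : TangentSpace I p} (hmin : IsMinimizingUpTo g hg p v 1)
    (hvq : riemannianExpMap g p v = q) : v ∈ tangentCutLocus g hg p := by
  haveI := fact_one_le_of_infty_le hn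
  obtain ⟨ℓ, hℓ⟩ : ∃ ℓ : ℝ, ℓ = Real.sqrt (g.val p v v) := ⟨_, rfl⟩
  have hq1 : q = maximalGeodesic g.leviCivita p v 1 := by
    rw [← hvq]
    exact expMap_eq_maximalGeodesic hc p v
  have hdpq : g.edist hg p q = ENNReal.ofReal ℓ := by
    rw [← hvq, hℓ]
    exact edist_eq_of_isMinimizingUpTo hg hc hmin
  have hv0 : v ≠ 0 := by
    rintro rfl
    exact hq.1 (by rw [← hvq]; exact riemannianExpMap_zero g p)
  have hℓpos : 0 < ℓ := by
    rw [hℓ]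
    exact Real.sqrt_pos.2 (hg p v hv0)
  refine ⟨hv0, hmin, fun s hs hmins => ?_⟩
  -- the point `r = γ_v(s)` beyond `q`
  have hdpr : g.edist hg p (maximalGeodesic g.leviCivita p v s) = ENNReal.ofReal (s * ℓ) := by
    rw [← hmins.2, length_maximalGeodesic hg hc p v 0 s, sub_zero, ← hℓ]
  have hdqr : g.edist hg q (maximalGeodesic g.leviCivita p v s) ≤
      ENNReal.ofReal ((s - 1) * ℓ) := by
    have h := edist_maximalGeodesic_le_length hg hc p v hs.le
    rw [length_maximalGeodesic hg hc p v 1 s, ← hℓ, ← hq1] at h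
    exact h
  have hs1ℓ : 0 ≤ (s - 1) * ℓ := mul_nonneg (by linarith) hℓpos.le
  -- equality in the triangle inequality through `q`
  have heq : g.edist hg p (maximalGeodesic g.leviCivita p v s) =
      g.edist hg p q + g.edist hg q (maximalGeodesic g.leviCivita p v s) := by
    refine le_antisymm (g.edist_triangle hg _ _ _) ?_
    rw [hdpr, hdpq]
    calc ENNReal.ofReal ℓ + g.edist hg q (maximalGeodesic g.leviCivita p v s)
        ≤ ENNReal.ofReal ℓ + ENNReal.ofReal ((s - 1) * ℓ) := by gcongr
      _ = ENNReal.ofReal (s * ℓ) := by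
          rw [← ENNReal.ofReal_add hℓpos.le hs1ℓ]
          congr 1
          ring
  have hrq : maximalGeodesic g.leviCivita p v s = q := hq.2 _ heq
  rw [hrq, g.edist_self hg, add_zero, hdpq] at heq
  -- `heq : d(p,q) = d(p,q)` is now trivial; recompute `d(p, γ_v s) = d(p, q)` numerically
  have hnum : ENNReal.ofReal (s * ℓ) = ENNReal.ofReal ℓ := by rw [← hdpr, hrq, hdpq]
  have hsl : s * ℓ = ℓ := (ENNReal.ofReal_eq_ofReal_iff (by positivity) hℓpos.le).1 hnum
  have hs1 : s = 1 := by
    have h : s * ℓ = 1 * ℓ := by rw [hsl, one_mul]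
    exact mul_right_cancel₀ hℓpos.ne' h
  exact absurd hs1 hs.ne'

/-! ### From the tangent cut locus to the metric cut locus -/

/-- **The exponential image of the tangent cut locus lies in the metric cut locus**: for a smooth
Riemannian metric with complete Levi-Civita connection on a connected Hausdorff manifold without
boundary, `v ∈ TCL(p)` implies `exp_p v ∈ cutLocus p`. With `q = exp_p v = γ_v(1)`: `q ≠ p`
since `d(p,q) = |v| > 0`; and if `r ≠ q` satisfied `d(p,r) = d(p,q) + d(q,r)`, a minimizing
segment `γ_w|[0,1]` from `q` to `r` (Hopf–Rinow) either continues `γ_v`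
(`w ∥ γ_v'(1)` positively: then `r = γ_v(s)`, `s = 1 + |w|/|v| > 1`, and `γ_v|[0,s]` has length
`|v| + |w| = d(p,r)`, so it minimizes — contradicting `v ∈ TCL(p)`), or makes a genuine corner
with it at `q`, in which case corner cutting (`exists_edist_riemannianExpMap_neg_smul_lt`) yields
points `a = γ_v(1 - s/|v|)`, `b = γ_w(s/|w|)` with `d(a,b) < 2s` and hence
`d(p,r) ≤ d(p,a) + d(a,b) + d(b,r) < (|v| - s) + 2s + (|w| - s) = d(p,r)`.
[cite: LeeRiemannianManifolds2018, Prop. 10.32 and Thm. 10.34 (c) (proof)] -/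
theorem expMap_mem_cutLocus_of_mem_tangentCutLocus [ConnectedSpace M] (hn : (∞ : ℕ∞ω) ≤ n)
    (hg : g.IsRiemannian) (hc : IsGeodesicallyComplete g.leviCivita) {p : M}
    {v : TangentSpace I p} (hv : v ∈ tangentCutLocus g hg p) :
    riemannianExpMap g p v ∈ cutLocus g hg p := by
  haveI := fact_one_le_of_infty_le hn
  haveI : LocallyCompactSpace M := Manifold.locallyCompact_of_finiteDimensional (M := M) I
  obtain ⟨hv0, hmin, hnot⟩ := hv
  obtain ⟨ℓ, hℓ⟩ : ∃ ℓ : ℝ, ℓ = Real.sqrt (g.val p v v) := ⟨_, rfl⟩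
  have hℓpos : 0 < ℓ := by
    rw [hℓ]
    exact Real.sqrt_pos.2 (hg p v hv0)
  have hℓsq : ℓ ^ 2 = g.val p v v := by
    rw [hℓ, Real.sq_sqrt (hg p v hv0).le]
  have hdom := (maximalGeodesic_of_isGeodesicallyComplete hc p v).1
  have hq1 : riemannianExpMap g p v = maximalGeodesic g.leviCivita p v 1 :=
    expMap_eq_maximalGeodesic hc p v
  have hdpq : g.edist hg p (maximalGeodesic g.leviCivita p v 1) = ENNReal.ofReal ℓ := by
    rw [← hq1, hℓ]
    exact edist_eq_of_isMinimizingUpTo hg hc hmin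
  rw [hq1, mem_cutLocus_iff]
  refine ⟨fun h => ?_, fun r hr => ?_⟩
  · -- `q ≠ p`
    rw [h, g.edist_self hg] at hdpq
    have : ℓ ≤ 0 := ENNReal.ofReal_eq_zero.1 hdpq.symm
    exact absurd this (not_le.2 hℓpos)
  by_contra hrq
  -- a minimizing segment from `q = γ_v(1)` to `r`
  obtain ⟨w, hwmin, hwr⟩ := exists_isMinimizingUpTo_of_isGeodesicallyComplete (g := g) hn hg hc
    (maximalGeodesic g.leviCivita p v 1) r
  obtain ⟨m, hm⟩ : ∃ m : ℝ, m = Real.sqrt (g.val (maximalGeodesic g.leviCivita p v 1) w w) :=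
    ⟨_, rfl⟩
  have hdqr : g.edist hg (maximalGeodesic g.leviCivita p v 1) r = ENNReal.ofReal m := by
    rw [← hwr, hm]
    exact edist_eq_of_isMinimizingUpTo hg hc hwmin
  have hm0 : 0 ≤ m := by
    rw [hm]
    exact Real.sqrt_nonneg _
  have hmpos : 0 < m := by
    rcases hm0.eq_or_lt with h0 | h0
    · exfalso
      apply hrq
      have h : g.edist hg (maximalGeodesic g.leviCivita p v 1) r = 0 := by
        rw [hdqr, ← h0, ENNReal.ofReal_zero]
      exact ((g.edist_eq_zero_iff hg).1 h).symm
    · exact h0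
  have hw0 : w ≠ 0 := by
    rintro rfl
    rw [hm] at hmpos
    simp at hmpos
  have hmsq : m ^ 2 = g.val (maximalGeodesic g.leviCivita p v 1) w w := by
    rw [hm, Real.sq_sqrt (hg _ w hw0).le]
  have hdpr : g.edist hg p r = ENNReal.ofReal (ℓ + m) := by
    rw [hr, hdpq, hdqr, ENNReal.ofReal_add hℓpos.le hm0]
  -- the incoming and outgoing unit directions at `q`
  obtain ⟨u, hu⟩ : ∃ u : TangentSpace I (maximalGeodesic g.leviCivita p v 1),
      u = velocity I (maximalGeodesic g.leviCivita p v) 1 := ⟨_, rfl⟩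
  have huu : g.val (maximalGeodesic g.leviCivita p v 1) u u = ℓ ^ 2 := by
    rw [hu, val_velocity_maximalGeodesic hc p v 1, hℓsq]
  have hû1 : g.val (maximalGeodesic g.leviCivita p v 1) (ℓ⁻¹ • u) (ℓ⁻¹ • u) = 1 := by
    simp only [map_smul, _root_.smul_apply, smul_eq_mul, huu]
    field_simp
  have hŵ1 : g.val (maximalGeodesic g.leviCivita p v 1) (m⁻¹ • w) (m⁻¹ • w) = 1 := by
    simp only [map_smul, _root_.smul_apply, smul_eq_mul, ← hmsq]
    field_simp
  by_cases huw : (ℓ⁻¹ • u : TangentSpace I (maximalGeodesic g.leviCivita p v 1)) = m⁻¹ • w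
  · -- Case A: `w` continues `γ_v`; then `γ_v` minimises beyond `1`
    have hw : w = (m * ℓ⁻¹) • u := by
      calc w = m • m⁻¹ • w := (smul_inv_smul₀ hmpos.ne' w).symm
        _ = m • ℓ⁻¹ • u := by rw [huw]
        _ = (m * ℓ⁻¹) • u := smul_smul m ℓ⁻¹ u
    have hrγ : r = maximalGeodesic g.leviCivita p v (m * ℓ⁻¹ + 1) := by
      rw [← hwr, hw, hu, expMap_smul_velocity_one hc p v]
    have hs1 : 1 < m * ℓ⁻¹ + 1 := lt_add_of_pos_left 1 (by positivity)
    refine hnot _ hs1 ⟨by rw [hdom]; exact subset_univ _, ?_⟩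
    rw [length_maximalGeodesic hg hc p v 0 (m * ℓ⁻¹ + 1), ← hℓ, ← hrγ, hdpr, sub_zero]
    congr 1
    field_simp
    ring
  · -- Case B: a genuine corner at `q`; cut it
    obtain ⟨s₀, hs₀, hcut⟩ := exists_edist_riemannianExpMap_neg_smul_lt (g := g) hn hg
      (maximalGeodesic g.leviCivita p v 1) (ℓ⁻¹ • u) (m⁻¹ • w) hû1 hŵ1 huw
    obtain ⟨s, hs⟩ : ∃ s : ℝ, s = min (s₀ / 2) (min ℓ m) := ⟨_, rfl⟩
    have hs0 : 0 < s := by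
      rw [hs]
      exact lt_min (by positivity) (lt_min hℓpos hmpos)
    have hss₀ : s < s₀ := by
      rw [hs]
      exact (min_le_left _ _).trans_lt (by linarith)
    have hsℓ : s ≤ ℓ := by
      rw [hs]
      exact (min_le_right _ _).trans (min_le_left _ _)
    have hsm : s ≤ m := by
      rw [hs]
      exact (min_le_right _ _).trans (min_le_right _ _)
    have hab := hcut s hs0 hss₀
    -- the two points `a = γ_v(1 - s/ℓ)` and `b = γ_w(s/m)`
    have ha : riemannianExpMap g (maximalGeodesic g.leviCivita p v 1) ((-s) • ℓ⁻¹ • u) =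
        riemannianExpMap g p ((1 - s / ℓ) • v) := by
      rw [smul_smul, hu, expMap_smul_velocity_one hc p v, riemannianExpMap_eq, expMap_smul hc p v]
      congr 1
      field_simp
      ring
    have hb : riemannianExpMap g (maximalGeodesic g.leviCivita p v 1) (s • m⁻¹ • w) =
        riemannianExpMap g (maximalGeodesic g.leviCivita p v 1) ((s / m) • w) := by
      rw [smul_smul, div_eq_mul_inv]
    rw [ha, hb] at hab
    have ht1 : 1 - s / ℓ ∈ Icc (0 : ℝ) 1 :=
      ⟨by rw [sub_nonneg, div_le_one hℓpos]; exact hsℓ,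
        by linarith [div_nonneg hs0.le hℓpos.le]⟩
    have ht2 : s / m ∈ Icc (0 : ℝ) 1 := ⟨div_nonneg hs0.le hm0, (div_le_one hmpos).2 hsm⟩
    have hpa : g.edist hg p (riemannianExpMap g p ((1 - s / ℓ) • v)) = ENNReal.ofReal (ℓ - s) := by
      rw [edist_self_expMap_smul_of_isMinimizingUpTo hg hc hmin ht1, ← hℓ]
      congr 1
      field_simp
    have hbr : g.edist hg (riemannianExpMap g (maximalGeodesic g.leviCivita p v 1) ((s / m) • w)) r
        = ENNReal.ofReal (m - s) := by
      rw [← hwr, edist_expMap_smul_expMap_of_isMinimizingUpTo hg hc hwmin ht2, ← hm]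
      congr 1
      field_simp
    -- `d(p, r) < d(p, r)`
    have hlt : g.edist hg p r < ENNReal.ofReal (ℓ + m) := by
      calc g.edist hg p r
          ≤ g.edist hg p (riemannianExpMap g (maximalGeodesic g.leviCivita p v 1) ((s / m) • w)) +
              g.edist hg (riemannianExpMap g (maximalGeodesic g.leviCivita p v 1) ((s / m) • w)) r :=
            g.edist_triangle hg _ _ _
        _ ≤ (g.edist hg p (riemannianExpMap g p ((1 - s / ℓ) • v)) +
              g.edist hg (riemannianExpMap g p ((1 - s / ℓ) • v))
                (riemannianExpMap g (maximalGeodesic g.leviCivita p v 1) ((s / m) • w))) +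
              g.edist hg (riemannianExpMap g (maximalGeodesic g.leviCivita p v 1) ((s / m) • w)) r := by
            gcongr
            exact g.edist_triangle hg _ _ _
        _ = ENNReal.ofReal (ℓ - s) +
              g.edist hg (riemannianExpMap g p ((1 - s / ℓ) • v))
                (riemannianExpMap g (maximalGeodesic g.leviCivita p v 1) ((s / m) • w)) +
              ENNReal.ofReal (m - s) := by rw [hpa, hbr]
        _ < ENNReal.ofReal (ℓ - s) + ENNReal.ofReal (2 * s) + ENNReal.ofReal (m - s) :=
            ENNReal.add_lt_add_right ENNReal.ofReal_ne_top
              (ENNReal.add_lt_add_left ENNReal.ofReal_ne_top hab)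
        _ = ENNReal.ofReal (ℓ + m) := by
            rw [← ENNReal.ofReal_add (by linarith) (by linarith),
              ← ENNReal.ofReal_add (by linarith) (by linarith)]
            congr 1
            ring
    rw [hdpr] at hlt
    exact lt_irrefl _ hlt

/-! ### The identification `cutLocus = Cut(p)` -/

/-- **The metric cut locus is Lee's `Cut(p) = exp_p(TCL(p))`** for a smooth Riemannian metric
with geodesically complete Levi-Civita connection on a connected Hausdorff manifold without
boundary: `cutLocus g hg p = geodesicCutLocus g hg p`. (`⊆`: join `p` to `q ∈ cutLocus p` by a
minimizing `γ_v|[0,1]` (Hopf–Rinow); `v ∈ TCL(p)` by `mem_tangentCutLocus_of_mem_cutLocus`.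
`⊇`: `expMap_mem_cutLocus_of_mem_tangentCutLocus`.) This is the identification of Buchner's /
Lee's cut locus with the metric `cutLocus` of `CutLocus.lean` announced there and in
`ExponentialMap.lean`. [cite: LeeRiemannianManifolds2018, p. 310 (Cut(p) = exp_p(TCL(p)))] -/
theorem cutLocus_eq_geodesicCutLocus [ConnectedSpace M] (hn : (∞ : ℕ∞ω) ≤ n)
    (hg : g.IsRiemannian) (hc : IsGeodesicallyComplete g.leviCivita) (p : M) :
    cutLocus g hg p = geodesicCutLocus g hg p := by
  refine Subset.antisymm (fun q hq => ?_) ?_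
  · obtain ⟨v, hmin, hvq⟩ :=
      exists_isMinimizingUpTo_of_isGeodesicallyComplete (g := g) hn hg hc p q
    exact ⟨v, mem_tangentCutLocus_of_mem_cutLocus hn hg hc hq hmin hvq, hvq⟩
  · rintro _ ⟨v, hv, rfl⟩
    exact expMap_mem_cutLocus_of_mem_tangentCutLocus hn hg hc hv

/-- **The tangent cut locus through the metric cut locus**: for `v ≠ 0` with `γ_v|[0,1]`
minimizing, `v ∈ TCL(p) ↔ exp_p v ∈ cutLocus p`. [cite: LeeRiemannianManifolds2018, p. 310] -/
theorem mem_tangentCutLocus_iff_expMap_mem_cutLocus [ConnectedSpace M] (hn : (∞ : ℕ∞ω) ≤ n)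
    (hg : g.IsRiemannian) (hc : IsGeodesicallyComplete g.leviCivita) {p : M}
    {v : TangentSpace I p} (hmin : IsMinimizingUpTo g hg p v 1) :
    v ∈ tangentCutLocus g hg p ↔ riemannianExpMap g p v ∈ cutLocus g hg p :=
  ⟨fun hv => expMap_mem_cutLocus_of_mem_tangentCutLocus hn hg hc hv,
    fun hq => mem_tangentCutLocus_of_mem_cutLocus hn hg hc hq hmin rfl⟩

/-- **On a compact connected manifold the metric cut locus is `Cut(p)`** (smooth Riemannian
metric; compact manifolds are geodesically complete, `hopfRinow_compact_geodesicallyComplete`).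
This is the setting of Buchner's theorem `buchner1977_cutLocus_triangulable`.
[cite: Buchner1977Simplicial, p. 118 (definition of C(p))] -/
theorem cutLocus_eq_geodesicCutLocus_of_compactSpace [CompactSpace M] [ConnectedSpace M]
    (hn : (∞ : ℕ∞ω) ≤ n) (hg : g.IsRiemannian) (p : M) :
    cutLocus g hg p = geodesicCutLocus g hg p :=
  cutLocus_eq_geodesicCutLocus hn hg (hopfRinow_compact_geodesicallyComplete hn hg) p

end Literature.Geometry.Riemannian

end
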